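import Summits.ABC.IUTFork.Cor312LicenceTripleLocalTypeSlot
import Summits.ABC.IUTFork.Conditional.RefBandsInhCells14321927484375B
import Summits.ABC.IUTFork.Conditional.AbcOfSGenuineKLinUniformRows2
import HarnessLib

/-!
# R-W «W:TS-BANDS», INH-type half: `3 * 5 ^ 6 * 7 ^ 8 * 53 + 167 ^ 9 = 2 * 11 ^ 6 * 193 ^ 4 * 20551` — S_H INHABITED at every datum with `e(·|167) = 10·l`, EVERY prime `l ≥ 153707347`

PROOF-ONLY file (D-0012: 0 definitions, 0 `Prop` facts, no instance, no notation) of the abc-iut cell — D-0079 RESCUE sub-cell R-W «WINDOW Θ-SIDE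
INEQUALITY», numerics-crew seat abc-iut-W-num-6 (gen 4), row «W:TS-BANDS» (abc-iut-plan g11 C-R97 (b): per-type band theorems closing the TYPE-SPLIT
residue of the whole-axis census; abc-iut-w5-d009 g14's `WRowFrey37569208117GapThirtyBand` = the shape of record). GENERATED by
HOME/abc-iut-W-num-6/refbands/emit_inhband.py v2.

CONTENT. At the pole `p = 167` (`v_p(abc) = 9`) the genuine class is `e ∈ 5·l·ℕ`; on the band `153707347 ≤ l < 307414715` the member
`e = 5·l` is NOT inhabited by this route (its REF-type half is `RefBandsExactType14321927484375` where filed) while the member `e = 10·l` IS: for EVERY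
prime `l ≥ 153707347` and EVERY genuine Θ-volume datum `T` whose places over `167` have `e(K_x/ℚ_167) = 10·l` (`hloc`), the licence HOLDS at
`settingPrVolSharp (pilotDataOfK T.D T.K) …` for every pair of realising ideles (`WRow.licence_triple_14321927484375_typeband_e10`) and so does branch C's
antecedent (`WRow.exists_qPinned_and_hull_triple_14321927484375_typeband_e10`) — abc-iut-W-row-1's hooked socket `WRow.licence_triple_slot_of_localType`
(hook `p = 167 → e = 10·l`, discharged by `hloc`) at this seat's `RefBand.inhcell_14321927484375_type` (`RefBandsInhCells14321927484375B`). From `l ≥ 307414715` the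
UNCONDITIONAL band `RefBandsInhBand14321927484375` supersedes this file. HONEST SCOPE: a PER-TYPE statement (it binds the local type at `167` only);
inhabited-AS-TYPED over OUR objects; admissibility / non-emptiness of the datum type (and of the sub-class) NOT claimed; nothing about the number-level
`Cor22.Cor312AtDatum`; typed ≠ proved; no side taken on [IUTchIII] Cor. 3.12; no abc claim.
-/

noncomputable section

open Set Function Metric NumberField IsDedekindDomain

namespace Summit.ABC.IUTFork.Conditional

open Thm311 Thm311.Real Cor312 Cor312Vol Cor312Prov Literature.IUT.LogThetaLattice Literature.IUT.LogVolume
  Literature.IUT.HodgeTheaters Literature.IUT.LogVolume.Cor22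
open Literature.NumberTheory.NumberFields Literature.NumberTheory.GaloisRepresentations.Ultrametric
open Literature.NumberTheory.DiophantineGeometry Literature.NumberTheory.DiophantineGeometry.GenEll

/-- **INH-TYPE BAND: `3 * 5 ^ 6 * 7 ^ 8 * 53 + 167 ^ 9 = 2 * 11 ^ 6 * 193 ^ 4 * 20551` at EVERY prime `l ≥ 153707347`, data with `e(·|167) = 10·l`.** For every genuine Θ-volume datum `T` at
`(ratPoint (a/c), l)` whose places over `167` have `e(K_x/ℚ_167) = 10·l` and every pair of realising Θ- and q-ideles:
`Thm311ToCor312.Licence (settingPrVolSharp (pilotDataOfK T.D T.K) …)` — W-row-1's hooked socket `WRow.licence_triple_slot_of_localType` (hook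
`p = 167 → e = 10·l`) at `RefBand.inhcell_14321927484375_type` (envelope exponents `if p = 3 then 0 else if p = 5 then 1 else if p = 7 then 3 else if p = 11 then 2 else if p = 53 then 0 else if p = 167 then 4 else if p = 193 then 1 else if p = 20551 then 0 else 0`). [cite: Mochizuki2012, IUTchI Def. 3.1 (b),(c) pp. 61–62, Ex. 3.2 (iv) p. 71; IUTchIII Cor. 3.12 Step (xi-f) p. 184; IUTchIV Prop. 1.1 p. 9, Prop. 1.2 (i)(ii) p. 10, Cor. 2.2 (ii) proof (P5) p. 46]
[cite: DupuyHilado2025, §3.3, §3.4, §4.9, §4.12] [claim: Mochizuki2012, status: disputed] -/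
theorem WRow.licence_triple_14321927484375_typeband_e10 {l : ℕ} (hl : l.Prime) (hl0 : 153707347 ≤ l)
    (T : Cor22.ThetaVolumeDatumAt (ratPoint (((3 * 5 ^ 6 * 7 ^ 8 * 53 : ℕ) : ℚ) / (2 * 11 ^ 6 * 193 ^ 4 * 20551 : ℕ))) l)
    (hloc : letI := T.instFieldF; letI := T.instNumberFieldF; letI := T.instAlgebraF; letI := T.instFieldK
      letI := T.instNumberFieldK; letI := T.instAlgebraK; letI := T.instFieldFbar; letI := T.instAlgebraFbar
      letI := T.instAlgebraKFbar; letI := T.instIsElliptic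
      haveI : Fact (Nat.Prime 167) := ⟨by norm_num⟩
      ∀ x₀ : (thetaIndex (pilotDataOfK T.D T.K)).Fibre (.inr ⟨167, by norm_num⟩),
        absRamificationIdx 167 (kOf (pilotDataOfK T.D T.K) 167 x₀) = 10 * l) :
    letI := T.instFieldF; letI := T.instNumberFieldF; letI := T.instAlgebraF; letI := T.instFieldK
    letI := T.instNumberFieldK; letI := T.instAlgebraK; letI := T.instFieldFbar; letI := T.instAlgebraFbar
    letI := T.instAlgebraKFbar; letI := T.instIsElliptic
    ∀ {logv : PadicLogs T.K} (hlog : LogvAnalytic logv) (M : Type) [Field M] [NumberField M]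
      (archPk : ∀ (j : (thetaIndex (pilotDataOfK T.D T.K)).Label) (vQ : (thetaIndex (pilotDataOfK T.D T.K)).VQ),
        Set ((logShellsDH (pilotDataOfK T.D T.K) logv).Packet j vQ))
      (archSub : ∀ (j : (thetaIndex (pilotDataOfK T.D T.K)).Label) (v : (thetaIndex (pilotDataOfK T.D T.K)).V),
        Set ((logShellsDH (pilotDataOfK T.D T.K) logv).Packet j ((thetaIndex (pilotDataOfK T.D T.K)).over v)))
      (Ψ : ℤ → ∀ v : (thetaIndex (pilotDataOfK T.D T.K)).V, v ∈ (thetaIndex (pilotDataOfK T.D T.K)).Vbad →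
        Set ((logShellsDH (pilotDataOfK T.D T.K) logv).StarPacket v))
      (act : ℤ → ∀ v : (thetaIndex (pilotDataOfK T.D T.K)).V, v ∈ (thetaIndex (pilotDataOfK T.D T.K)).Vbad →
        (logShellsDH (pilotDataOfK T.D T.K) logv).StarPacket v → Module.End ℚ ((logShellsDH (pilotDataOfK T.D T.K) logv).StarPacket v))
      (Mmod : ℤ → ∀ j : (thetaIndex (pilotDataOfK T.D T.K)).LabelStar, Set ((logShellsDH (pilotDataOfK T.D T.K) logv).GlobalPacket j.1))
      (region : ℤ → ∀ j : (thetaIndex (pilotDataOfK T.D T.K)).LabelStar, FinDivisor M → ∀ vQ : (thetaIndex (pilotDataOfK T.D T.K)).VQ,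
        Set ((logShellsDH (pilotDataOfK T.D T.K) logv).Packet j.1 vQ))
      (n : ℤ) {HT : Type} {LogLink : HT → HT → Type} {IsFull : ∀ {s t : HT}, LogLink s t → Prop}
      (lat : LGPGaussianLogThetaLattice LogLink IsFull)
      {Frd : Type} {IsoF : Frd → Frd → Type} {Ob : Frd → Type} {realify : Frd → Frd} {Strip : Type}
      {IsoS : Strip → Strip → Type} {Mv : ∀ v : (thetaIndex (pilotDataOfK T.D T.K)).V, v ∈ (thetaIndex (pilotDataOfK T.D T.K)).Vbad → Type}
      [∀ v h, Monoid (Mv v h)]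
      (sig : GlobalLGPFrobenioidSignature (thetaIndex (pilotDataOfK T.D T.K)).lstar (thetaIndex (pilotDataOfK T.D T.K)).V
        (· ∈ (thetaIndex (pilotDataOfK T.D T.K)).Vbad) Frd IsoF Ob realify Strip IsoS Mv)
      (split : SplittingMonoids Mv) {ObΔ : Type} {N : ∀ v : (thetaIndex (pilotDataOfK T.D T.K)).V, v ∈ (thetaIndex (pilotDataOfK T.D T.K)).Vbad → Type}
      [∀ v h, Monoid (N v h)] (qData : QPilotData ObΔ N)
      (tq : ∀ (pp : Nat.Primes) (x : (thetaIndex (pilotDataOfK T.D T.K)).Fibre (.inr pp)),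
        haveI : Fact (pp : ℕ).Prime := ⟨pp.2⟩; kOf (pilotDataOfK T.D T.K) pp.1 x)
      (t : ∀ (pp : Nat.Primes) (_ : Fin (pilotDataOfK T.D T.K).lstar) (x : (thetaIndex (pilotDataOfK T.D T.K)).Fibre (.inr pp)),
        haveI : Fact (pp : ℕ).Prime := ⟨pp.2⟩; kOf (pilotDataOfK T.D T.K) pp.1 x)
      (htq0 : ∀ pp x, tq pp x ≠ 0)
      (htq1 : ∀ (pp : Nat.Primes) (x : (thetaIndex (pilotDataOfK T.D T.K)).Fibre (.inr pp)),
        haveI : Fact (pp : ℕ).Prime := ⟨pp.2⟩; placeOf (pilotDataOfK T.D T.K) pp.1 x ∉ (pilotDataOfK T.D T.K).S → ‖tq pp x‖ = 1)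
      (_ht0 : ∀ pp i x, t pp i x ≠ 0)
      (_ht : ∀ (pp : Nat.Primes) (i : Fin (pilotDataOfK T.D T.K).lstar) (x : (thetaIndex (pilotDataOfK T.D T.K)).Fibre (.inr pp)),
        haveI : Fact (pp : ℕ).Prime := ⟨pp.2⟩
        Real.log ‖t pp i x‖ = -((pilotDataOfK T.D T.K).thetaPilot i (placeOf (pilotDataOfK T.D T.K) pp.1 x)) *
          logNorm T.K (placeOf (pilotDataOfK T.D T.K) pp.1 x) / localDegree T.K (placeOf (pilotDataOfK T.D T.K) pp.1 x))
      (_htq : ∀ (pp : Nat.Primes) (x : (thetaIndex (pilotDataOfK T.D T.K)).Fibre (.inr pp)),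
        haveI : Fact (pp : ℕ).Prime := ⟨pp.2⟩
        Real.log ‖tq pp x‖ = -((pilotDataOfK T.D T.K).qPilot (placeOf (pilotDataOfK T.D T.K) pp.1 x)) *
          logNorm T.K (placeOf (pilotDataOfK T.D T.K) pp.1 x) / localDegree T.K (placeOf (pilotDataOfK T.D T.K) pp.1 x)),
      Thm311ToCor312.Licence
        (settingPrVolSharp (pilotDataOfK T.D T.K) hlog M archPk archSub Ψ act Mmod region n lat sig split qData tq t htq0 htq1) :=
  WRow.licence_triple_slot_of_localType isABCTriple_frey14321927484375 (by rw [Cor22.jInv_ratPoint_triple isABCTriple_frey14321927484375]; norm_num) T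
    (fun p => if p = 3 then 0 else if p = 5 then 1 else if p = 7 then 3 else if p = 11 then 2 else if p = 53 then 0 else if p = 167 then 4 else if p = 193 then 1 else if p = 20551 then 0 else 0) (fun p => if p = 3 then 0 else if p = 5 then 1 else if p = 7 then 3 else if p = 11 then 2 else if p = 53 then 0 else if p = 167 then 4 else if p = 193 then 1 else if p = 20551 then 0 else 0) (fun p e => (167 = p → e = 10 * l))
    (by
      intro pp x _ hpp
      obtain rfl : pp = ⟨167, by norm_num⟩ := Subtype.ext hpp.symm
      exact hloc x) (RefBand.inhcell_14321927484375_type hl hl0)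

/-- **Hence branch C's per-datum antecedent «∃ ρ qK, QPinned ∧ PilotKummerCompatHull» HOLDS** at every such datum (any columns `col`; every pair of
realising Θ- and q-ideles), EVERY prime `l ≥ 153707347`, data with `e(·|167) = 10·l`. [cite: Mochizuki2012, IUTchIII Cor. 3.12 Step (xi-d) p. 183, (xi-f) p. 184] [cite: DupuyHilado2025, §3.3, §3.4, §4.9] [claim: Mochizuki2012, status: disputed] -/
theorem WRow.exists_qPinned_and_hull_triple_14321927484375_typeband_e10 {l : ℕ} (hl : l.Prime) (hl0 : 153707347 ≤ l)
    (T : Cor22.ThetaVolumeDatumAt (ratPoint (((3 * 5 ^ 6 * 7 ^ 8 * 53 : ℕ) : ℚ) / (2 * 11 ^ 6 * 193 ^ 4 * 20551 : ℕ))) l)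
    (hloc : letI := T.instFieldF; letI := T.instNumberFieldF; letI := T.instAlgebraF; letI := T.instFieldK
      letI := T.instNumberFieldK; letI := T.instAlgebraK; letI := T.instFieldFbar; letI := T.instAlgebraFbar
      letI := T.instAlgebraKFbar; letI := T.instIsElliptic
      haveI : Fact (Nat.Prime 167) := ⟨by norm_num⟩
      ∀ x₀ : (thetaIndex (pilotDataOfK T.D T.K)).Fibre (.inr ⟨167, by norm_num⟩),
        absRamificationIdx 167 (kOf (pilotDataOfK T.D T.K) 167 x₀) = 10 * l) :
    letI := T.instFieldF; letI := T.instNumberFieldF; letI := T.instAlgebraF; letI := T.instFieldK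
    letI := T.instNumberFieldK; letI := T.instAlgebraK; letI := T.instFieldFbar; letI := T.instAlgebraFbar
    letI := T.instAlgebraKFbar; letI := T.instIsElliptic
    ∀ {logv : PadicLogs T.K} (hlog : LogvAnalytic logv) (M : Type) [Field M] [NumberField M]
      (archPk : ∀ (j : (thetaIndex (pilotDataOfK T.D T.K)).Label) (vQ : (thetaIndex (pilotDataOfK T.D T.K)).VQ),
        Set ((logShellsDH (pilotDataOfK T.D T.K) logv).Packet j vQ))
      (archSub : ∀ (j : (thetaIndex (pilotDataOfK T.D T.K)).Label) (v : (thetaIndex (pilotDataOfK T.D T.K)).V),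
        Set ((logShellsDH (pilotDataOfK T.D T.K) logv).Packet j ((thetaIndex (pilotDataOfK T.D T.K)).over v)))
      (Ψ : ℤ → ∀ v : (thetaIndex (pilotDataOfK T.D T.K)).V, v ∈ (thetaIndex (pilotDataOfK T.D T.K)).Vbad →
        Set ((logShellsDH (pilotDataOfK T.D T.K) logv).StarPacket v))
      (act : ℤ → ∀ v : (thetaIndex (pilotDataOfK T.D T.K)).V, v ∈ (thetaIndex (pilotDataOfK T.D T.K)).Vbad →
        (logShellsDH (pilotDataOfK T.D T.K) logv).StarPacket v → Module.End ℚ ((logShellsDH (pilotDataOfK T.D T.K) logv).StarPacket v))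
      (Mmod : ℤ → ∀ j : (thetaIndex (pilotDataOfK T.D T.K)).LabelStar, Set ((logShellsDH (pilotDataOfK T.D T.K) logv).GlobalPacket j.1))
      (region : ℤ → ∀ j : (thetaIndex (pilotDataOfK T.D T.K)).LabelStar, FinDivisor M → ∀ vQ : (thetaIndex (pilotDataOfK T.D T.K)).VQ,
        Set ((logShellsDH (pilotDataOfK T.D T.K) logv).Packet j.1 vQ))
      (n : ℤ) {HT : Type} {LogLink : HT → HT → Type} {IsFull : ∀ {s t : HT}, LogLink s t → Prop}
      (lat : LGPGaussianLogThetaLattice LogLink IsFull)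
      {Frd : Type} {IsoF : Frd → Frd → Type} {Ob : Frd → Type} {realify : Frd → Frd} {Strip : Type}
      {IsoS : Strip → Strip → Type} {Mv : ∀ v : (thetaIndex (pilotDataOfK T.D T.K)).V, v ∈ (thetaIndex (pilotDataOfK T.D T.K)).Vbad → Type}
      [∀ v h, Monoid (Mv v h)]
      (sig : GlobalLGPFrobenioidSignature (thetaIndex (pilotDataOfK T.D T.K)).lstar (thetaIndex (pilotDataOfK T.D T.K)).V
        (· ∈ (thetaIndex (pilotDataOfK T.D T.K)).Vbad) Frd IsoF Ob realify Strip IsoS Mv)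
      (split : SplittingMonoids Mv) {ObΔ : Type} {N : ∀ v : (thetaIndex (pilotDataOfK T.D T.K)).V, v ∈ (thetaIndex (pilotDataOfK T.D T.K)).Vbad → Type}
      [∀ v h, Monoid (N v h)] (qData : QPilotData ObΔ N)
      (tq : ∀ (pp : Nat.Primes) (x : (thetaIndex (pilotDataOfK T.D T.K)).Fibre (.inr pp)),
        haveI : Fact (pp : ℕ).Prime := ⟨pp.2⟩; kOf (pilotDataOfK T.D T.K) pp.1 x)
      (t : ∀ (pp : Nat.Primes) (_ : Fin (pilotDataOfK T.D T.K).lstar) (x : (thetaIndex (pilotDataOfK T.D T.K)).Fibre (.inr pp)),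
        haveI : Fact (pp : ℕ).Prime := ⟨pp.2⟩; kOf (pilotDataOfK T.D T.K) pp.1 x)
      (htq0 : ∀ pp x, tq pp x ≠ 0)
      (htq1 : ∀ (pp : Nat.Primes) (x : (thetaIndex (pilotDataOfK T.D T.K)).Fibre (.inr pp)),
        haveI : Fact (pp : ℕ).Prime := ⟨pp.2⟩; placeOf (pilotDataOfK T.D T.K) pp.1 x ∉ (pilotDataOfK T.D T.K).S → ‖tq pp x‖ = 1)
      (col : ℤ → Column (logShellsDH (pilotDataOfK T.D T.K) logv))
      (_ht0 : ∀ pp i x, t pp i x ≠ 0)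
      (_ht : ∀ (pp : Nat.Primes) (i : Fin (pilotDataOfK T.D T.K).lstar) (x : (thetaIndex (pilotDataOfK T.D T.K)).Fibre (.inr pp)),
        haveI : Fact (pp : ℕ).Prime := ⟨pp.2⟩
        Real.log ‖t pp i x‖ = -((pilotDataOfK T.D T.K).thetaPilot i (placeOf (pilotDataOfK T.D T.K) pp.1 x)) *
          logNorm T.K (placeOf (pilotDataOfK T.D T.K) pp.1 x) / localDegree T.K (placeOf (pilotDataOfK T.D T.K) pp.1 x))
      (_htq : ∀ (pp : Nat.Primes) (x : (thetaIndex (pilotDataOfK T.D T.K)).Fibre (.inr pp)),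
        haveI : Fact (pp : ℕ).Prime := ⟨pp.2⟩
        Real.log ‖tq pp x‖ = -((pilotDataOfK T.D T.K).qPilot (placeOf (pilotDataOfK T.D T.K) pp.1 x)) *
          logNorm T.K (placeOf (pilotDataOfK T.D T.K) pp.1 x) / localDegree T.K (placeOf (pilotDataOfK T.D T.K) pp.1 x)),
      ∃ (ρ : (∀ v : (thetaIndex (pilotDataOfK T.D T.K)).V, v ∈ (thetaIndex (pilotDataOfK T.D T.K)).Vbad →
              Set ((logShellsDH (pilotDataOfK T.D T.K) logv).StarPacket v)) →
            ∀ (j : (thetaIndex (pilotDataOfK T.D T.K)).Label) (vQ : (thetaIndex (pilotDataOfK T.D T.K)).VQ),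
              Set ((logShellsDH (pilotDataOfK T.D T.K) logv).Packet j vQ))
          (qK : ∀ v : (thetaIndex (pilotDataOfK T.D T.K)).V, v ∈ (thetaIndex (pilotDataOfK T.D T.K)).Vbad →
            Set ((logShellsDH (pilotDataOfK T.D T.K) logv).StarPacket v)),
          QPinned ({ toSituation := situationPrVol (pilotDataOfK T.D T.K) hlog M archPk archSub Ψ act Mmod region, col := col } :
              LatticeSituation (thetaIndex (pilotDataOfK T.D T.K)))
            (settingPrVolSharp (pilotDataOfK T.D T.K) hlog M archPk archSub Ψ act Mmod region n lat sig split qData tq t htq0 htq1) ρ qK ∧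
          PilotKummerCompatHull ({ toSituation := situationPrVol (pilotDataOfK T.D T.K) hlog M archPk archSub Ψ act Mmod region, col := col } :
              LatticeSituation (thetaIndex (pilotDataOfK T.D T.K)))
            (settingPrVolSharp (pilotDataOfK T.D T.K) hlog M archPk archSub Ψ act Mmod region n lat sig split qData tq t htq0 htq1) ρ qK :=
  WRow.exists_qPinned_and_hull_triple_slot_of_localType isABCTriple_frey14321927484375 (by rw [Cor22.jInv_ratPoint_triple isABCTriple_frey14321927484375]; norm_num) T
    (fun p => if p = 3 then 0 else if p = 5 then 1 else if p = 7 then 3 else if p = 11 then 2 else if p = 53 then 0 else if p = 167 then 4 else if p = 193 then 1 else if p = 20551 then 0 else 0) (fun p => if p = 3 then 0 else if p = 5 then 1 else if p = 7 then 3 else if p = 11 then 2 else if p = 53 then 0 else if p = 167 then 4 else if p = 193 then 1 else if p = 20551 then 0 else 0) (fun p e => (167 = p → e = 10 * l))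
    (by
      intro pp x _ hpp
      obtain rfl : pp = ⟨167, by norm_num⟩ := Subtype.ext hpp.symm
      exact hloc x) (RefBand.inhcell_14321927484375_type hl hl0)

end Summit.ABC.IUTFork.Conditional

end
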